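import Summits.AtomisticToContinuum.BoseEinsteinCondensation.Theorems.BECCutLineWeakDisorderWitnessTransferEnvelope
import Summits.AtomisticToContinuum.BoseEinsteinCondensation.Theorems.BECCutLineWeakDisorderWitnessTransferLevelSet
import Literature.MathematicalPhysics.QuantumManyBody.GroundStateFeynmanKacCompact
import Literature.MathematicalPhysics.QuantumManyBody.BoseGasHardSet
import Mathlib.Topology.MetricSpace.Thickening
import HarnessLib

/-!
# Route BECCutLineWeakDisorder — `WitnessTransfer`, line `Sketch`: (E2) reduces to vanishing AT
the hard-set configurations

Support file (does not close the item) for the crux stmt-AtomisticToContinuum-14978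
(`Summit.AtomisticToContinuum.BoseEinsteinCondensation.Theses.BECCutLineWeakDisorder.WitnessTransfer`).
The open input (E2) `stub_vanish` of line `Sketch` asks for UNIFORM smallness of `e^{-TH_N}1`
near the hard-set configurations `H = {X | ∃ i ≠ j, xᵢ − xⱼ ∈ hardVec v}`. Here it is reduced to
the POINTWISE statement `e^{-TH_N}1 = 0` on `H` (almost-sure infinite action when a pair STARTS at
a hard relative position — the local-time statement, and nothing more):

* `fkSemigroup_anti_potential` — the Feynman–Kac functional decreases with the potential;
* `stub_vanish_of_pointwise` — (E2) from the pointwise vanishing. Proof: the superlevel set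
  `K = {e^{-TH}1 ≥ η}` keeps a margin from the walls (`glue_wall_vanish`), and
  `e^{-TH}1 = inf_k e^{-TH_k}1` over the truncations `min v k` (`tendsto_fkSemigroup_min_one`),
  each CONTINUOUS inside the box (strong Feller, `continuousAt_fkReal`), so `K` is an intersection
  of closed sets: compact; `H` is closed and disjoint from `K`, whence a positive separation
  (`Disjoint.exists_thickenings`).
-/

noncomputable section

open MeasureTheory Filter Set Metric
open scoped ENNReal NNReal Topology

namespace Summit.AtomisticToContinuum.BoseEinsteinCondensation.Theorems.CutLineWitness

open Literature.MathematicalPhysics.QuantumManyBody.BoseGas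

/-- **The Feynman–Kac functional decreases with the potential**: `v ≤ w` pointwise implies
`e^{-TH_w} g ≤ e^{-TH_v} g`. [folklore] -/
theorem fkSemigroup_anti_potential {N : ℕ} {v w : ℝ → ℝ≥0∞} (h : ∀ r, v r ≤ w r) (L T : ℝ)
    (g : Config N → ℝ≥0∞) (X : Config N) : fkSemigroup w L T g X ≤ fkSemigroup v L T g X := by
  refine lintegral_mono fun ω => mul_le_mul_left ?_ _
  unfold fkWeight
  by_cases hω : ω ∈ survives L T X
  · rw [Set.indicator_of_mem hω, Set.indicator_of_mem hω]
    exact expNeg_antitone (pathAction_mono_potential h T X ω)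
  · rw [Set.indicator_of_notMem hω, Set.indicator_of_notMem hω]

/-- **(E2) from the pointwise vanishing at the hard-set configurations.** For measurable
`v : ℝ → [0,∞]`, `T > 0`: if `(e^{-TH_N}1)(X) = 0` whenever some `xᵢ − xⱼ` (`i ≠ j`) lies IN the
hard set `hardVec v`, then for every `η > 0` there is `κ > 0` with `(e^{-TH_N}1)(X) ≤ η` whenever
some `xᵢ − xⱼ` is within `κ` of the hard set. [cite: ChungZhao1995, Thm 3.17] -/
theorem stub_vanish_of_pointwise {N : ℕ} {v : ℝ → ℝ≥0∞} (hv : Measurable v) (L : ℝ) {T : ℝ}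
    (hT : 0 < T)
    (hZ : ∀ X : Config N, (∃ i j : Fin N, i ≠ j ∧ X i - X j ∈ hardVec v) →
      fkSemigroup v L T (fun _ => (1 : ℝ≥0∞)) X = 0)
    {η : ℝ} (hη : 0 < η) :
    ∃ κ : ℝ, 0 < κ ∧ ∀ X : Config N,
      (∃ i j : Fin N, i ≠ j ∧ ∃ z ∈ hardVec v, dist (X i - X j) z < κ) →
        fkSemigroup v L T (fun _ => (1 : ℝ≥0∞)) X ≤ ENNReal.ofReal η := by
  classical
  set F : Config N → ℝ≥0∞ := fun X => fkSemigroup v L T (fun _ => (1 : ℝ≥0∞)) X with hFdef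
  set Fk : ℕ → Config N → ℝ≥0∞ := fun k X =>
    fkSemigroup (fun r => min (v r) (k : ℝ≥0∞)) L T (fun _ => (1 : ℝ≥0∞)) X with hFkdef
  -- the margin from the walls
  obtain ⟨κw, hκw, Hw⟩ := glue_wall_vanish (N := N) v L hT (half_pos hη)
  have hη2 : ENNReal.ofReal (η / 2) < ENNReal.ofReal η :=
    (ENNReal.ofReal_lt_ofReal_iff hη).2 (by linarith)
  set Bw : Set (Config N) := {X | ∀ i k, κw ≤ X i k ∧ X i k ≤ L - κw} with hBwdef
  have hcoord : ∀ (i : Fin N) (k : Fin 3), Continuous fun X : Config N => X i k :=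
    fun i k => (EuclideanSpace.proj k).continuous.comp (continuous_apply i)
  have hBwclosed : IsClosed Bw := by
    simp only [hBwdef, Set.setOf_forall]
    exact isClosed_iInter fun i => isClosed_iInter fun k =>
      (isClosed_le continuous_const (hcoord i k)).inter (isClosed_le (hcoord i k) continuous_const)
  have hBwbox : Bw ⊆ boxN N L := fun X hX i k => by
    have h := hX i k; constructor <;> linarith [h.1, h.2]
  have hBwbdd : Bornology.IsBounded Bw :=
    ((isBounded_iff_subset_closedBall (0 : Config N)).2
      ⟨3 * |L|, boxN_subset_closedBall N L⟩).subset hBwbox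
  -- the superlevel set `K`
  set K : Set (Config N) := {X | ENNReal.ofReal η ≤ F X} with hKdef
  have hKBw : K ⊆ Bw := by
    intro X hX i k
    by_contra hcon
    have h' : ∃ i k, X i k < κw ∨ L - κw < X i k := by
      refine ⟨i, k, ?_⟩
      rcases not_and_or.1 hcon with h | h
      · exact Or.inl (not_le.1 h)
      · exact Or.inr (not_le.1 h)
    exact absurd ((Hw X h').trans_lt hη2) (not_lt.2 hX)
  -- `K` as an intersection of closed sets
  have hFle : ∀ k X, F X ≤ Fk k X := fun k X =>
    fkSemigroup_anti_potential (fun r => min_le_left (v r) (k : ℝ≥0∞)) L T _ X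
  have hKeq : K = Bw ∩ ⋂ k : ℕ, {X | ENNReal.ofReal η ≤ Fk k X} := by
    ext X
    simp only [Set.mem_inter_iff, Set.mem_iInter, Set.mem_setOf_eq]
    constructor
    · intro hX
      exact ⟨hKBw hX, fun k => le_trans hX (hFle k X)⟩
    · rintro ⟨-, hX⟩
      exact ge_of_tendsto (tendsto_fkSemigroup_min_one hv L T X) (Eventually.of_forall hX)
  have hFk_eq : ∀ k X, Fk k X = ENNReal.ofReal
      (fkReal (fun r => min (v r) (k : ℝ≥0∞)) L T (fun _ => (1 : ℝ)) X) := by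
    intro k X
    rw [fkReal_eq_toReal_fkSemigroup (measurable_min_natCast hv k) L T measurable_const
      (fun _ => zero_le_one) X]
    simp only [ENNReal.ofReal_one]
    rw [ENNReal.ofReal_toReal]
    exact ((fkPartition_le_one _ L T X).trans_lt ENNReal.one_lt_top).ne
  have hclosed_k : ∀ k : ℕ, IsClosed (Bw ∩ {X | ENNReal.ofReal η ≤ Fk k X}) := by
    intro k
    have hcont : ContinuousOn (fkReal (fun r => min (v r) (k : ℝ≥0∞)) L T (fun _ => (1 : ℝ))) Bw :=
      fun X hX => (continuousAt_fkReal (measurable_min_natCast hv k) (C := k)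
        (fun r => min_le_right _ _) L hT measurable_const (by
          rw [setLIntegral_const]
          simp only [enorm_one, ENNReal.one_rpow, one_mul]
          exact (volume_boxN_lt_top N L).ne) (hBwbox hX)).continuousWithinAt
    have hset : Bw ∩ {X | ENNReal.ofReal η ≤ Fk k X} =
        Bw ∩ (fkReal (fun r => min (v r) (k : ℝ≥0∞)) L T (fun _ => (1 : ℝ))) ⁻¹' Set.Ici η := by
      ext X
      simp only [Set.mem_inter_iff, Set.mem_setOf_eq, Set.mem_preimage, Set.mem_Ici, hFk_eq]
      exact and_congr_right fun _ => ENNReal.ofReal_le_ofReal_iff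
        (fkReal_nonneg _ L T (fun _ => zero_le_one) X)
    rw [hset]
    exact hcont.preimage_isClosed_of_isClosed hBwclosed isClosed_Ici
  have hKclosed : IsClosed K := by
    rw [hKeq, Set.inter_iInter]
    exact isClosed_iInter hclosed_k
  have hKcompact : IsCompact K :=
    Metric.isCompact_of_isClosed_isBounded hKclosed (hBwbdd.subset hKBw)
  -- the hard-set configurations
  set H : Set (Config N) := {X | ∃ i j : Fin N, i ≠ j ∧ X i - X j ∈ hardVec v} with hHdef
  have hHclosed : IsClosed H := by
    have hH : H = ⋃ i : Fin N, ⋃ j : Fin N, {X | i ≠ j ∧ X i - X j ∈ hardVec v} := by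
      ext X; simp [hHdef]
    rw [hH]
    refine isClosed_iUnion_of_finite fun i => isClosed_iUnion_of_finite fun j => ?_
    by_cases hij : i = j
    · convert isClosed_empty using 1
      exact Set.eq_empty_of_forall_notMem fun X hX => hX.1 hij
    · have : {X : Config N | i ≠ j ∧ X i - X j ∈ hardVec v} =
          (fun X : Config N => X i - X j) ⁻¹' hardVec v := by
        ext X; simp [hij]
      rw [this]
      exact isClosed_hardVec.preimage ((continuous_apply i).sub (continuous_apply j))
  have hdisj : Disjoint K H := by
    refine Set.disjoint_left.2 fun X hXK hXH => ?_
    have h0 : F X = 0 := hZ X hXH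
    have : ENNReal.ofReal η ≤ 0 := h0 ▸ hXK
    exact absurd (le_antisymm this bot_le) (ENNReal.ofReal_pos.2 hη).ne'
  obtain ⟨δ, hδ, hthick⟩ := hdisj.exists_thickenings hKcompact hHclosed
  refine ⟨δ, hδ, fun X hX => ?_⟩
  obtain ⟨i, j, hij, z, hz, hlt⟩ := hX
  -- a hard-set configuration within `δ` of `X`
  set Y : Config N := Function.update X i (X j + z) with hYdef
  have hYH : Y ∈ H := by
    refine ⟨i, j, hij, ?_⟩
    rw [hYdef, Function.update_self, Function.update_of_ne hij.symm]
    simpa using hz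
  have hXY : dist X Y < δ := by
    have hle : dist X Y ≤ dist (X i - X j) z := by
      refine (dist_pi_le_iff dist_nonneg).2 fun l => ?_
      by_cases hl : l = i
      · subst hl
        rw [hYdef, Function.update_self, dist_eq_norm, dist_eq_norm]
        rw [show X l - (X j + z) = X l - X j - z by abel]
      · rw [hYdef, Function.update_of_ne hl, dist_self]; exact dist_nonneg
    exact hle.trans_lt hlt
  have hXthick : X ∈ Metric.thickening δ H := Metric.mem_thickening_iff.2 ⟨Y, hYH, hXY⟩
  have hXnotK : X ∉ K := fun hXK =>
    (Set.disjoint_left.1 hthick) (Metric.self_subset_thickening hδ K hXK) hXthick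
  exact le_of_lt (not_le.1 hXnotK)

end Summit.AtomisticToContinuum.BoseEinsteinCondensation.Theorems.CutLineWitness

end
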